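import Mathlib
import HarnessLib
import Literature.Analysis.FluidPDE.SelfSimilar
import Literature.Analysis.FluidPDE.LocalTypeI
import Literature.Analysis.FluidPDE.VectorCalculus
import Literature.Analysis.FluidPDE.SwirlTransportProofs
import Literature.Analysis.FluidPDE.LerayProfileCalculus
import Literature.Analysis.FluidPDE.TsaiMaximumPrinciple
import Literature.Analysis.FluidPDE.TsaiProfileEndgame
import Literature.Analysis.FluidPDE.CurlFreeLiouville
import Literature.Analysis.UnboundedOperators.HeatKernel
import Summits.NavierStokesRegularity.NavierStokesRegularity.Theorems.LocalSineTubeDoorProfileAlignedWindowRigidityAncient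
import Summits.NavierStokesRegularity.NavierStokesRegularity.Theorems.PoloidalWindowDoorPoloidalWindowRigidityClassRate
import Summits.NavierStokesRegularity.NavierStokesRegularity.Theorems.PoloidalWindowDoorPoloidalWindowRigidityOneSlice
import Summits.NavierStokesRegularity.NavierStokesRegularity.Theorems.PoloidalWindowDoorPoloidalWindowRigidityFlat
import Summits.NavierStokesRegularity.NavierStokesRegularity.Theorems.PoloidalWindowDoorPoloidalWindowRigidityRotatedLeray
import Summits.NavierStokesRegularity.NavierStokesRegularity.Theorems.PoloidalWindowDoorPoloidalWindowRigidityRotatedLerayLiouville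
import Summits.NavierStokesRegularity.NavierStokesRegularity.Theorems.PoloidalWindowDoorPoloidalWindowRigidityRotDriftLiouville
import Summits.NavierStokesRegularity.NavierStokesRegularity.Theorems.PoloidalWindowDoorPoloidalWindowRigiditySpiralSelfSimilar

/-!
# Route `PoloidalWindowDoor`, crux `PoloidalWindowRigidity` (K2, stmt-NavierStokesRegularity-19708) —
# POLOIDAL ROTATED SELF-SIMILAR PROFILES ARE TRIVIAL FOR EVERY ROTATION RATE

Cell ns-regularity-ideate, seat ns-poloidal-K2-p2 (stub-worker; `--supports` the crux, `--as helper`).  Conclusion of the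
series `…RotatedLeray` (the identity `νΔΠ_β − DΠ_β[U + ay + βJy] = (ν/2)|DU − DUᵀ|² + 2νβ(curl U)₂`),
`…RotatedLerayLiouville` (`|β| < a`), `…RotDriftLiouville` (Tsai's Lemma 5.1 with a skew drift) and
`…SpiralSelfSimilar` (the K2 stratum for `|κ| < 1`): the rotation drift `βJy` is SKEW, so the rate restriction
disappears.

* `rotatedLeray_const_of_poloidal_all` — `ν > 0`, `a > 0`, ANY `β`: a bounded POLOIDAL (`(curl U)₂ ≡ 0`) solution
  `U ∈ C³`, `P ∈ C²` (polynomial growth) of `−νΔU + aU + aDU[y] + β(DU[Jy] − JU) + DU[U] + ∇P = 0`, `div U = 0`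
  has constant velocity (`isConst_of_driftOp_nonneg_skew_of_poly` with `T = βJ`);
* **`eq_zero_of_spiralSelfSimilar_vertical_all`** — a profile of the route's Type-I class, poloidal along `e₃`,
  invariant under a spiral subgroup `e^r v(e^{2r}s, e^r R_{κr} y) = R_{κr} v(s,y)` (all `r`, `s < 0`, `y`; ANY
  `κ ∈ ℝ`) vanishes identically; `nonflatLiouville_of_spiralSelfSimilar_vertical_all`;
* `eq_zero_of_spiralSelfSimilar_centre` — the same about the vertical axis through any centre `c`
  (`…Axisymmetric.class_translate`).

So **Perelman's rotated self-similar ansatz has NO poloidal representative with bounded profile**, at any rotation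
rate; together with `…Similarity` (tilted axes) the residue of K2 has no one-parameter space–time symmetry at all
(backward DISCRETE self-similarity, Bradshaw–Tsai OP 5.1, remains).

WHAT THIS IS NOT: not a claim about Navier–Stokes regularity; not Perelman's problem for general (non-poloidal)
profiles, where the defect `2νβω₂` is genuinely present (bears_on LADDER-NS N0, rung N0-LocalTubeDoorPoloidal).
-/

noncomputable section

-- the summit and its single sub-problem share the name (CONVENTIONS §1), as in every Theorems file
set_option linter.dupNamespace false

namespace Summit.NavierStokesRegularity.NavierStokesRegularity.Theorems.PoloidalWindowDoorPoloidalWindowRigidityRotatedLerayAllRates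

open MeasureTheory Set Function Filter Topology TopologicalSpace Metric InnerProductSpace
open scoped RealInnerProductSpace InnerProductSpace Laplacian ContDiff
open Literature.Analysis Literature.Analysis.FluidPDE
open Summit.NavierStokesRegularity.NavierStokesRegularity.Theorems.LocalSineTubeDoorProfileAlignedWindowRigidityAncient
open Summit.NavierStokesRegularity.NavierStokesRegularity.Theorems.PoloidalWindowDoorPoloidalWindowRigidityClassRate
open Summit.NavierStokesRegularity.NavierStokesRegularity.Theorems.PoloidalWindowDoorPoloidalWindowRigidityOneSlice
open Summit.NavierStokesRegularity.NavierStokesRegularity.Theorems.PoloidalWindowDoorPoloidalWindowRigidityRotatedLeray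
open Summit.NavierStokesRegularity.NavierStokesRegularity.Theorems.PoloidalWindowDoorPoloidalWindowRigidityRotatedLerayLiouville
open Summit.NavierStokesRegularity.NavierStokesRegularity.Theorems.PoloidalWindowDoorPoloidalWindowRigidityRotDriftLiouville
open Summit.NavierStokesRegularity.NavierStokesRegularity.Theorems.PoloidalWindowDoorPoloidalWindowRigiditySpiralSelfSimilar

variable {C : ℝ} {v : ℝ → EuclideanSpace ℝ (Fin 3) → EuclideanSpace ℝ (Fin 3)}

/-! ### the rotated Leray Liouville theorem for every rate -/

/-- **POLOIDAL ROTATED LERAY PROFILES WITH BOUNDED VELOCITY ARE CONSTANT — every rotation rate `β`.** -/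
theorem rotatedLeray_const_of_poloidal_all {ν a β M C' : ℝ} {N : ℕ}
    {U : EuclideanSpace ℝ (Fin 3) → EuclideanSpace ℝ (Fin 3)} {P : EuclideanSpace ℝ (Fin 3) → ℝ}
    (hν : 0 < ν) (ha : 0 < a) (hU3 : ContDiff ℝ 3 U) (hP2 : ContDiff ℝ 2 P)
    (hpe : ∀ y, -(ν • (Δ U) y) + a • U y + a • fderiv ℝ U y y + β • (fderiv ℝ U y (rotGen y) - rotGen (U y)) +
      convect U U y + gradient P y = 0)
    (hdiv : VectorCalculus.IsDivFree U) (hpol : ∀ y, curl U y 2 = 0)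
    (hUbdd : ∀ y, ‖U y‖ ≤ M) (hPpoly : ∀ y, |P y| ≤ C' * (1 + ‖y‖) ^ N) (x y : EuclideanSpace ℝ (Fin 3)) :
    U x = U y := by
  have hU2 : ContDiff ℝ 2 U := hU3.of_le (by norm_num)
  have hM : 0 ≤ M := (norm_nonneg _).trans (hUbdd 0)
  have hC' : 0 ≤ C' := by
    have h := (abs_nonneg _).trans (hPpoly 0)
    rw [norm_zero, add_zero, one_pow, mul_one] at h
    exact h
  -- the rotated head pressure: `C²`, polynomially bounded subsolution for the drift `(U + βJ·) + a y`
  set Θ : EuclideanSpace ℝ (Fin 3) → ℝ := fun z => headPressure a U P z + β * ⟪rotGen z, U z⟫ with hΘ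
  have hΘ2 : ContDiff ℝ 2 Θ := contDiff_rotHead hU2 hP2
  have hsub : ∀ z, 0 ≤ driftOp ν a (fun z => U z + β • rotGen z) Θ z :=
    driftOp_rotHead_nonneg_of_poloidal hν.le hU3 hP2 hpe hdiv hpol
  have hgrowth : ∀ z, |Θ z| ≤ (2⁻¹ * M ^ 2 + C' + a * M + |β| * M) * (1 + ‖z‖) ^ (N + 2) :=
    abs_rotHead_le ha.le hM hC' hUbdd hPpoly
  -- the skew part `T = βJ` of the drift
  set T : EuclideanSpace ℝ (Fin 3) →L[ℝ] EuclideanSpace ℝ (Fin 3) := β • rotGenL with hT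
  have hTskew : ∀ w, ⟪T w, w⟫ = 0 := fun w => by
    rw [hT, FunLike.coe_smul, Pi.smul_apply, rotGenL_apply, real_inner_smul_left, inner_rotGen_self, mul_zero]
  have hW : ∀ z, U z + β • rotGen z = U z + T z := fun z => by
    rw [hT, FunLike.coe_smul, Pi.smul_apply, rotGenL_apply]
  -- `U` is bounded: linear rate `b = a/2 < a` beyond `r₀ = 2M/a`
  have hb0 : (0 : ℝ) ≤ a / 2 := by positivity
  have hba : a / 2 < a := by linarith
  have hU' : ∀ z, 2 * M / a ≤ ‖z‖ → ‖U z‖ ≤ a / 2 * ‖z‖ := by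
    intro z hz
    have h1 : 2 * M ≤ a * ‖z‖ := by
      have h := (div_le_iff₀ ha).1 hz
      linarith
    calc ‖U z‖ ≤ M := hUbdd z
      _ ≤ a / 2 * ‖z‖ := by linarith
  have hconst : ∀ z w, Θ z = Θ w := fun z w =>
    isConst_of_driftOp_nonneg_skew_of_poly hν hb0 hba T hTskew hW hΘ2 hU2.continuous hsub hU' hgrowth z w
  -- endgame as in `…RotatedLerayLiouville`
  have hΘfun : Θ = fun _ => Θ 0 := funext fun z => hconst z 0
  have hzero : ∀ z, driftOp ν a (fun z => U z + β • rotGen z) Θ z = 0 := by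
    intro z
    rw [driftOp, hΘfun, laplacian_const_eq_zero, fderiv_fun_const]
    simp
  have hcurl : ∀ z, curl U z = 0 := by
    intro z
    have h1 := driftOp_rotHead_of_poloidal hU3 hP2 hpe hdiv hpol z
    rw [← hΘ, hzero z] at h1
    have h2 : frobeniusNormSq (spin U z) = 0 := by
      have : ν / 2 ≠ 0 := by positivity
      have h3 : ν / 2 * frobeniusNormSq (spin U z) = 0 := h1.symm
      exact (mul_eq_zero.1 h3).resolve_left this
    exact curl_eq_zero_of_spin_eq_zero z (eq_zero_of_frobeniusNormSq_eq_zero h2)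
  exact eq_of_curl_eq_zero_of_isDivFree_of_bounded hU2 hcurl hdiv hUbdd x y

/-! ### the K2 stratum for every rotation rate -/

/-- **ROTATING SELF-SIMILARITY ABOUT THE VERTICAL AXIS THROUGH THE ORIGIN: EMPTY, every rate `κ`.** -/
theorem eq_zero_of_spiralSelfSimilar_vertical_all (hrate : HasTypeITimeDecay C v)
    (hcont : ContinuousOn (uncurry v) (Iio (0 : ℝ) ×ˢ univ))
    (hmild : ∀ s t : ℝ, s < t → t < 0 → ∀ x,
      v t x = UnboundedOperators.heatExtension (v s) (t - s) x - oseenDuhamel 1 s v v t x)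
    (hdiv : ∀ t < 0, VectorCalculus.IsDivFree (v t))
    (hpol : ∀ s < 0, ∀ y, ⟪curl (v s) y, EuclideanSpace.single 2 1⟫_ℝ = 0) (κ : ℝ)
    (hrss : ∀ r : ℝ, ∀ s < 0, ∀ y, Real.exp r • v (Real.exp r ^ 2 * s) (Real.exp r • rotZ (κ * r) y) =
      rotZ (κ * r) (v s y)) :
    ∀ t < 0, ∀ x, v t x = 0 := by
  have hbdd := bdd_of_hasTypeITimeDecay hrate
  have hneg1 : (-1 : ℝ) < 0 := by norm_num
  obtain ⟨P, hP2, hpe⟩ := profileEq_of_rss hrate hcont hmild hdiv hrss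
  have hU3 : ContDiff ℝ 3 (v (-1)) := (analyticOnNhd_slice hcont hbdd hmild hneg1).contDiff
  have hpol1 : ∀ y, curl (v (-1)) y 2 = 0 := fun y => by
    have h1 := hpol (-1) hneg1 y
    rwa [EuclideanSpace.inner_single_right, one_mul, conj_trivial] at h1
  have hUbdd : ∀ y, ‖v (-1) y‖ ≤ C := fun y => by
    have h := hrate (-1) hneg1 y
    rwa [neg_neg, Real.sqrt_one, div_one] at h
  obtain ⟨C₁, hC₁⟩ := exists_fderiv_rate_of_class hrate hcont hmild
  have hDU : ∀ y, ‖fderiv ℝ (v (-1)) y‖ ≤ C₁ := fun y => by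
    have h := hC₁ (-1) hneg1 y
    rwa [neg_neg, div_one] at h
  obtain ⟨K, hK⟩ := exists_laplacian_bound hrate hcont hmild hdiv
  have hM : 0 ≤ C := (norm_nonneg _).trans (hUbdd 0)
  have hC₁0 : 0 ≤ C₁ := (norm_nonneg _).trans (hDU 0)
  have hK0 : 0 ≤ K := (norm_nonneg _).trans (hK 0)
  have hgrad := norm_fderiv_pressure_le hpe hUbdd hDU hK
  have hA : 0 ≤ |(1 : ℝ)| * K + |(1 / 2 : ℝ)| * C + |κ / 2| * C + C₁ * C := by positivity
  have hB : 0 ≤ |(1 / 2 : ℝ)| * C₁ + |κ / 2| * C₁ := by positivity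
  have hPpoly := abs_le_sq_of_norm_fderiv_le_affine (hP2.differentiable (by norm_num)) hA hB hgrad
  have hconst : ∀ x y, v (-1) x = v (-1) y :=
    rotatedLeray_const_of_poloidal_all one_pos (by norm_num) hU3 hP2 hpe (hdiv (-1) hneg1) hpol1 hUbdd hPpoly
  have hne : (EuclideanSpace.single 0 1 : EuclideanSpace ℝ (Fin 3)) ≠ 0 := fun h0 => by
    simpa using congrArg (fun w : EuclideanSpace ℝ (Fin 3) => w 0) h0
  exact eq_zero_of_translate_eq_slice hrate hcont hmild hdiv hneg1 hne fun y l => hconst _ _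

/-- Not backward-singular, every rate. -/
theorem nonflatLiouville_of_spiralSelfSimilar_vertical_all (hrate : HasTypeITimeDecay C v)
    (hcont : ContinuousOn (uncurry v) (Iio (0 : ℝ) ×ˢ univ))
    (hmild : ∀ s t : ℝ, s < t → t < 0 → ∀ x,
      v t x = UnboundedOperators.heatExtension (v s) (t - s) x - oseenDuhamel 1 s v v t x)
    (hdiv : ∀ t < 0, VectorCalculus.IsDivFree (v t))
    (hpol : ∀ s < 0, ∀ y, ⟪curl (v s) y, EuclideanSpace.single 2 1⟫_ℝ = 0) (κ : ℝ)
    (hrss : ∀ r : ℝ, ∀ s < 0, ∀ y, Real.exp r • v (Real.exp r ^ 2 * s) (Real.exp r • rotZ (κ * r) y) =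
      rotZ (κ * r) (v s y)) :
    ¬ IsBackwardSingularPoint v 0 :=
  Summit.NavierStokesRegularity.NavierStokesRegularity.Theorems.PoloidalWindowDoorPoloidalWindowRigidityFlat.not_backwardSingular_of_zero
    (eq_zero_of_spiralSelfSimilar_vertical_all hrate hcont hmild hdiv hpol κ hrss)

/-- **Rotating self-similarity about the vertical axis through ANY centre `c`, every rate: EMPTY** (translate `c`
to the origin with `…Axisymmetric.class_translate`; poloidality is translation invariant). -/
theorem eq_zero_of_spiralSelfSimilar_centre (hrate : HasTypeITimeDecay C v)
    (hcont : ContinuousOn (uncurry v) (Iio (0 : ℝ) ×ˢ univ))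
    (hmild : ∀ s t : ℝ, s < t → t < 0 → ∀ x,
      v t x = UnboundedOperators.heatExtension (v s) (t - s) x - oseenDuhamel 1 s v v t x)
    (hdiv : ∀ t < 0, VectorCalculus.IsDivFree (v t))
    (hpol : ∀ s < 0, ∀ y, ⟪curl (v s) y, EuclideanSpace.single 2 1⟫_ℝ = 0)
    (c : EuclideanSpace ℝ (Fin 3)) (κ : ℝ)
    (hrss : ∀ r : ℝ, ∀ s < 0, ∀ y, Real.exp r • v (Real.exp r ^ 2 * s) (Real.exp r • rotZ (κ * r) y + c) =
      rotZ (κ * r) (v s (y + c))) :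
    ∀ t < 0, ∀ x, v t x = 0 := by
  obtain ⟨hrate₁, hcont₁, hmild₁, hdiv₁⟩ :=
    Summit.NavierStokesRegularity.NavierStokesRegularity.Theorems.PoloidalWindowDoorPoloidalWindowRigidityAxisymmetric.class_translate
      c hrate hcont hmild hdiv
  have hpol₁ : ∀ s < 0, ∀ y, ⟪curl ((fun t y => v t (y + c)) s) y, EuclideanSpace.single 2 1⟫_ℝ = 0 := by
    intro s hs y
    have hc : curl (fun z => v s (z + c)) y = curl (v s) (y + c) := by
      rw [curl_eq_curlCLM, curl_eq_curlCLM, fderiv_comp_add_right]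
    show ⟪curl (fun z => v s (z + c)) y, EuclideanSpace.single 2 1⟫_ℝ = 0
    rw [hc]
    exact hpol s hs (y + c)
  have hzero := eq_zero_of_spiralSelfSimilar_vertical_all hrate₁ hcont₁ hmild₁ hdiv₁ hpol₁ κ
    (fun r s hs y => hrss r s hs y)
  intro t ht x
  have h := hzero t ht (x - c)
  simp only [sub_add_cancel] at h
  exact h

end Summit.NavierStokesRegularity.NavierStokesRegularity.Theorems.PoloidalWindowDoorPoloidalWindowRigidityRotatedLerayAllRates

end
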